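import Mathlib
import HarnessLib
import Summits.HubbardSuperconductivity.HubbardSuperconductivity.Theorems.KLProgrammeC4aFirstOrderTubePieceJoint

/-!
# Route `KLProgramme` — crux C4a, S3 brick (B4) «(U1)-HYBRID» B-1 (xii′): the tube piece with joint-`C⁰` kernel data is `C¹` IN THE BASE ANGLE — continuity of the
# first-order level-box line in `θ`, `deriv = ` the line, `ContDiff ℝ 1`

Cell `gate-hubbard-kl`, seat hubbard-kl-k3c3-p3 (g38; row «implicit-function / monotonicity route for μ(n)»).  Companion of B-1 (xii) `…C4aFirstOrderTubePieceJoint`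
(`hasDerivAt_tubePiece_joint` at every `θ`) for the (C)-closer lane / the `M₁` assembly (stub (C) `stub_twoLeg_curvature` of `KLRegimeEngineV17F2`,
stmt-HubbardSuperconductivity-20437), memo HOME/hubbard-kl-k3c3-p3/SWAP-BY-SYMMETRY.md.  `CoMovingJetsL1Theta N …` asks `ContDiff ℝ N` of the co-moving reading; at
`N = 1` this is differentiability plus CONTINUITY OF THE DERIVATIVE in the base angle, which for the tube piece is the continuity of
`θ ↦ ∫_{−hi}^{hi} f(e) ∫_{−π}^{π} J(e,v+θ)·G(θ,e,v)·(K e)′(ē(θ,e,v)) dv de` — one more parametric-continuity step (integrand jointly continuous in `(e,v,θ)`, the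
loop level clamped to `[−hi,hi]` as in B-1 (xii)).
* `continuous_firstOrderLine_param` — `(e,θ) ↦ ∫_{−π}^{π} J·G·(K e)′(ē) dv` is continuous on `[−hi,hi] × ℝ` (as a function on `ℝ²` after clamping);
* **`continuous_firstOrderLevelBox`** — `θ ↦ ∫_{−hi}^{hi} f(e)·(∫_{−π}^{π} J·G·(K e)′(ē) dv) de` is continuous;
* **`deriv_tubePiece_joint`** — `deriv (tube piece) = θ ↦ ((level box : ℝ) : ℂ)` as functions;
* **`contDiff_one_tubePiece_joint`** (HEADLINE) — the tube piece is `ContDiff ℝ 1` in the base angle.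
Sizes binder shape of B-1 (xii); nothing asserts (C), K3, the window or superconductivity.
References: BGM 2006 §2.4 (2.40) [cite: BenfattoGiulianiMastropietro2006]; FST II CPAM 51 (1998) §3 [cite: FeldmanSalmhoferTrubowitz1998].
-/

noncomputable section

namespace Summit.HubbardSuperconductivity.HubbardSuperconductivity.Theorems.C4a

set_option linter.dupNamespace false -- summit = problem name (single-conjunct summit), D-0017

open Real Set Filter MeasureTheory intervalIntegral Metric
open scoped Topology Interval
open Literature.MathematicalPhysics.QuantumLattice Literature.MathematicalPhysics.QuantumLattice.BandSectorCounting Literature.Probability.LatticeModels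
open Summit.HubbardSuperconductivity.HubbardSuperconductivity.Theorems.KLRegimeSplit
open Summit.HubbardSuperconductivity.HubbardSuperconductivity.Theorems.DispersionFlow
open Summit.HubbardSuperconductivity.HubbardSuperconductivity.Theorems.PerturbedFermiCurve

section Sizes

variable {K : TrigPolyC4v} {A : ℝ} (hA : ∀ p : Momentum, ∀ j ≤ 2, ‖iteratedFDeriv ℝ j (frameShift K) p‖ ≤ A) (hA20 : A ≤ 1 / 20)
  (hd : klCurveD ≤ (bandBounds (show (-4 : ℝ) < -1.1 by norm_num) (show (-1.1 : ℝ) ≤ -0.1 by norm_num)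
    (show (-0.1 : ℝ) < 0 by norm_num)).Dtmin - 2 * A)
  {μ r : ℝ} (hr : 0 < r) (hlo : (-1.1 : ℝ) < μ - r - A) (hhi : μ + r + A < -0.1)
  {A₃ A₄ : ℝ} (hA₃ : ∀ p : Momentum, ‖iteratedFDeriv ℝ 3 (frameShift K) p‖ ≤ A₃)
  (hA₄ : ∀ p : Momentum, ‖iteratedFDeriv ℝ 4 (frameShift K) p‖ ≤ A₄)
  {K₁ : ℝ} (hK₁ : ∀ p : Momentum, ‖fderiv ℝ (frameLevel μ K) p‖ ≤ K₁)
include hA hA20 hd hr hlo hhi hA₃ hA₄ hK₁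

/-! ## §1 Joint continuity of the first-order line in (level, base angle) -/

omit hA20 hA₃ hA₄ hK₁ in
set_option maxHeartbeats 400000 in
/-- **The first-order line is jointly continuous in `(θ, e)`** after clamping the level to `[−hi, hi]`:
`(θ,e) ↦ ∫_{−π}^{π} J(ẽ,v+θ)·G(θ,ẽ,v)·(K ẽ)′(ē(θ,ẽ,v)) dv`, `ẽ = max(−hi, min(e, hi))`, is continuous on `ℝ²`. -/
theorem continuous_firstOrderLine_param {ρ : ℝ} (hρ : |ρ| < r) (ϑ : ℝ) {hi : ℝ} (hhi0 : 0 ≤ hi) (hhir : hi < r) {Kr : ℝ → ℝ → ℝ}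
    (hKc : Continuous fun p : ℝ × ℝ => deriv (Kr p.1) p.2) :
    Continuous fun q : ℝ × ℝ => ∫ v in (-π)..π, levelChartJac μ K (max (-hi) (min q.2 hi), v + q.1) *
        (fderiv ℝ (frameLevel μ K) (pairSumPath μ K ρ ϑ q.1 0 - levelPoint μ K (max (-hi) (min q.2 hi)) (v + q.1)))
          (iteratedDeriv 1 (levelPoint μ K 0) q.1 + iteratedDeriv 1 (levelPoint μ K ρ) (ϑ + q.1)) *
        deriv (Kr (max (-hi) (min q.2 hi))) (frameLevel μ K (pairSumPath μ K ρ ϑ q.1 0 - levelPoint μ K (max (-hi) (min q.2 hi)) (v + q.1))) := by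
  set B := bandBounds (show (-4 : ℝ) < -1.1 by norm_num) (show (-1.1 : ℝ) ≤ -0.1 by norm_num) (show (-0.1 : ℝ) < 0 by norm_num) with hBdef
  have hADt : 2 * A < B.Dtmin := by have := klCurveD_pos; linarith only [this, hd]
  have h0r : |(0 : ℝ)| < r := by rw [abs_zero]; exact hr
  have hlev : ContinuousOn (fun p : ℝ × ℝ => levelPoint μ K p.1 p.2) ({x : ℝ | |x| < r} ×ˢ univ) :=
    (contDiffOn_levelPoint B hA hADt hlo hhi (m := 0)).continuousOn
  have hjac : ContinuousOn (levelChartJac μ K) ({x : ℝ | |x| < r} ×ˢ univ) := (contDiffOn_levelChartJac B hA hADt hlo hhi).continuousOn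
  have hfl : Continuous (frameLevel μ K) := (EngineV8.contDiff_frameLevel μ K (n := 0)).continuous
  have hDfl : Continuous (fderiv ℝ (frameLevel μ K)) := (EngineV8.contDiff_frameLevel μ K (n := 1)).continuous_fderiv one_ne_zero
  have hc0 : Continuous (levelPoint μ K 0) := (contDiff_levelPoint_angle B hA hADt hlo hhi h0r (m := 0)).continuous
  have hcρ : Continuous (levelPoint μ K ρ) := (contDiff_levelPoint_angle B hA hADt hlo hhi hρ (m := 0)).continuous
  have hd0 : Continuous (iteratedDeriv 1 (levelPoint μ K 0)) := (contDiff_levelPoint_angle B hA hADt hlo hhi h0r (m := 1)).continuous_iteratedDeriv 1 le_rfl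
  have hdρ : Continuous (iteratedDeriv 1 (levelPoint μ K ρ)) := (contDiff_levelPoint_angle B hA hADt hlo hhi hρ (m := 1)).continuous_iteratedDeriv 1 le_rfl
  have hhh : -hi ≤ hi := by linarith only [hhi0]
  -- variables: t = ((θ, e), v) ∈ (ℝ × ℝ) × ℝ
  have hcl : Continuous fun t : (ℝ × ℝ) × ℝ => max (-hi) (min t.1.2 hi) :=
    continuous_const.max ((continuous_snd.comp continuous_fst).min continuous_const)
  have hclI : ∀ t : (ℝ × ℝ) × ℝ, max (-hi) (min t.1.2 hi) ∈ Icc (-hi) hi := fun t => ⟨le_max_left _ _, max_le hhh (min_le_right _ _)⟩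
  have hclr : ∀ t : (ℝ × ℝ) × ℝ, |max (-hi) (min t.1.2 hi)| < r := fun t =>
    abs_lt.2 ⟨by linarith only [(hclI t).1, hhir], lt_of_le_of_lt (hclI t).2 hhir⟩
  have hθ : Continuous fun t : (ℝ × ℝ) × ℝ => t.1.1 := continuous_fst.comp continuous_fst
  have hang : Continuous fun t : (ℝ × ℝ) × ℝ => t.2 + t.1.1 := continuous_snd.add hθ
  have hL := hlev.comp_continuous (f := fun t : (ℝ × ℝ) × ℝ => ((max (-hi) (min t.1.2 hi), t.2 + t.1.1) : ℝ × ℝ))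
    (hcl.prodMk hang) fun t => mem_prod.2 ⟨hclr t, mem_univ _⟩
  have hL' : Continuous fun t : (ℝ × ℝ) × ℝ => levelPoint μ K (max (-hi) (min t.1.2 hi)) (t.2 + t.1.1) := hL.congr fun _ => rfl
  have hJ := hjac.comp_continuous (f := fun t : (ℝ × ℝ) × ℝ => ((max (-hi) (min t.1.2 hi), t.2 + t.1.1) : ℝ × ℝ))
    (hcl.prodMk hang) fun t => mem_prod.2 ⟨hclr t, mem_univ _⟩
  have hJ' : Continuous fun t : (ℝ × ℝ) × ℝ => levelChartJac μ K (max (-hi) (min t.1.2 hi), t.2 + t.1.1) := hJ.congr fun _ => rfl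
  have hS : Continuous fun t : (ℝ × ℝ) × ℝ => pairSumPath μ K ρ ϑ t.1.1 0 := by
    simp only [pairSumPath, add_zero]
    exact (hc0.comp hθ).add (hcρ.comp (continuous_const.add hθ))
  have harg : Continuous fun t : (ℝ × ℝ) × ℝ => pairSumPath μ K ρ ϑ t.1.1 0 - levelPoint μ K (max (-hi) (min t.1.2 hi)) (t.2 + t.1.1) := hS.sub hL'
  have hband : Continuous fun t : (ℝ × ℝ) × ℝ => frameLevel μ K (pairSumPath μ K ρ ϑ t.1.1 0 - levelPoint μ K (max (-hi) (min t.1.2 hi)) (t.2 + t.1.1)) :=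
    hfl.comp harg
  have hvec : Continuous fun t : (ℝ × ℝ) × ℝ => iteratedDeriv 1 (levelPoint μ K 0) t.1.1 + iteratedDeriv 1 (levelPoint μ K ρ) (ϑ + t.1.1) :=
    (hd0.comp hθ).add (hdρ.comp (continuous_const.add hθ))
  have hGf : Continuous fun t : (ℝ × ℝ) × ℝ => (fderiv ℝ (frameLevel μ K) (pairSumPath μ K ρ ϑ t.1.1 0 - levelPoint μ K (max (-hi) (min t.1.2 hi)) (t.2 + t.1.1)))
      (iteratedDeriv 1 (levelPoint μ K 0) t.1.1 + iteratedDeriv 1 (levelPoint μ K ρ) (ϑ + t.1.1)) :=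
    (hDfl.comp harg).clm_apply hvec
  have hKcl : Continuous fun t : (ℝ × ℝ) × ℝ => deriv (Kr (max (-hi) (min t.1.2 hi)))
      (frameLevel μ K (pairSumPath μ K ρ ϑ t.1.1 0 - levelPoint μ K (max (-hi) (min t.1.2 hi)) (t.2 + t.1.1))) :=
    (hKc.comp (hcl.prodMk hband)).congr fun _ => rfl
  have hG : Continuous (Function.uncurry fun (q : ℝ × ℝ) (v : ℝ) => levelChartJac μ K (max (-hi) (min q.2 hi), v + q.1) *
      (fderiv ℝ (frameLevel μ K) (pairSumPath μ K ρ ϑ q.1 0 - levelPoint μ K (max (-hi) (min q.2 hi)) (v + q.1)))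
        (iteratedDeriv 1 (levelPoint μ K 0) q.1 + iteratedDeriv 1 (levelPoint μ K ρ) (ϑ + q.1)) *
      deriv (Kr (max (-hi) (min q.2 hi))) (frameLevel μ K (pairSumPath μ K ρ ϑ q.1 0 - levelPoint μ K (max (-hi) (min q.2 hi)) (v + q.1)))) :=
    (hJ'.mul hGf).mul hKcl
  exact intervalIntegral.continuous_parametric_intervalIntegral_of_continuous' (μ := volume) hG (-π) π

omit hA20 hA₃ hA₄ hK₁ in
set_option maxHeartbeats 400000 in
/-- **The first-order LEVEL BOX is continuous in the base angle**: for `f` continuous on `[−hi,hi]` and `∂ᵤK` jointly continuous,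
`θ ↦ ∫_{−hi}^{hi} f(e)·(∫_{−π}^{π} J(e,v+θ)·G(θ,e,v)·(K e)′(ē) dv) de` is continuous. -/
theorem continuous_firstOrderLevelBox {ρ : ℝ} (hρ : |ρ| < r) (ϑ : ℝ) {hi : ℝ} (hhi0 : 0 ≤ hi) (hhir : hi < r) {f : ℝ → ℝ}
    (hfc : ContinuousOn f (Icc (-hi) hi)) {Kr : ℝ → ℝ → ℝ} (hKc : Continuous fun p : ℝ × ℝ => deriv (Kr p.1) p.2) :
    Continuous fun θ : ℝ => ∫ e in (-hi)..hi, f e * ∫ v in (-π)..π, levelChartJac μ K (e, v + θ) *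
        (fderiv ℝ (frameLevel μ K) (pairSumPath μ K ρ ϑ θ 0 - levelPoint μ K e (v + θ)))
          (iteratedDeriv 1 (levelPoint μ K 0) θ + iteratedDeriv 1 (levelPoint μ K ρ) (ϑ + θ)) *
        deriv (Kr e) (frameLevel μ K (pairSumPath μ K ρ ϑ θ 0 - levelPoint μ K e (v + θ))) := by
  have hhh : -hi ≤ hi := by linarith only [hhi0]
  have hline := continuous_firstOrderLine_param hA hd hr hlo hhi hρ ϑ hhi0 hhir hKc
  -- the clamped weight `f(ẽ)` is continuous on ℝ
  have hclc : Continuous fun e : ℝ => max (-hi) (min e hi) := continuous_const.max (continuous_id.min continuous_const)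
  have hclI : ∀ e : ℝ, max (-hi) (min e hi) ∈ Icc (-hi) hi := fun e => ⟨le_max_left _ _, max_le hhh (min_le_right _ _)⟩
  have hfcl : Continuous fun e : ℝ => f (max (-hi) (min e hi)) := hfc.comp_continuous hclc hclI
  have hF : Continuous (Function.uncurry fun (θ : ℝ) (e : ℝ) => f (max (-hi) (min e hi)) *
      ∫ v in (-π)..π, levelChartJac μ K (max (-hi) (min e hi), v + θ) *
        (fderiv ℝ (frameLevel μ K) (pairSumPath μ K ρ ϑ θ 0 - levelPoint μ K (max (-hi) (min e hi)) (v + θ)))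
          (iteratedDeriv 1 (levelPoint μ K 0) θ + iteratedDeriv 1 (levelPoint μ K ρ) (ϑ + θ)) *
        deriv (Kr (max (-hi) (min e hi))) (frameLevel μ K (pairSumPath μ K ρ ϑ θ 0 - levelPoint μ K (max (-hi) (min e hi)) (v + θ)))) :=
    (hfcl.comp continuous_snd).mul hline
  have hcont := intervalIntegral.continuous_parametric_intervalIntegral_of_continuous' (μ := volume) hF (-hi) hi
  refine hcont.congr fun θ => ?_
  refine intervalIntegral.integral_congr fun e he => ?_
  have he' : e ∈ Icc (-hi) hi := by rwa [uIcc_of_le hhh] at he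
  have hce : max (-hi) (min e hi) = e := by rw [min_eq_left he'.2, max_eq_right he'.1]
  simp only [hce]

/-! ## §2 The tube piece is `C¹` in the base angle -/

/-- **The derivative of the tube piece as a function of the base angle.** -/
theorem deriv_tubePiece_joint {f : ℝ → ℝ} {hi W : ℝ} (hhi0 : 0 ≤ hi) (hhir : hi < r) (hfc : ContinuousOn f (Icc (-hi) hi))
    (hfW : ∀ e ∈ Icc (-hi) hi, |f e| ≤ W)
    {Kr : ℝ → ℝ → ℝ} (hKd : ∀ e ∈ Icc (-hi) hi, ContDiff ℝ 2 (Kr e)) (hKc0 : Continuous fun p : ℝ × ℝ => Kr p.1 p.2)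
    (hKc : Continuous fun p : ℝ × ℝ => deriv (Kr p.1) p.2) {M₀ M₁ : ℝ} (hK0 : ∀ e ∈ Icc (-hi) hi, ∀ u, |Kr e u| ≤ M₀)
    (hK1 : ∀ e ∈ Icc (-hi) hi, ∀ u, |deriv (Kr e) u| ≤ M₁) {ρ : ℝ} (hρ : |ρ| < r) (ϑ : ℝ) :
    deriv (fun θ : ℝ => ∫ e in (-hi)..hi, ((f e : ℝ) : ℂ) * ∫ φ in Ioo (-π) π,
        (levelChartJac μ K (e, φ + θ) : ℝ) • ((Kr e (frameLevel μ K (levelPoint μ K 0 θ + levelPoint μ K ρ (ϑ + θ) - levelPoint μ K e (φ + θ))) : ℝ) : ℂ)) =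
      fun θ₀ : ℝ => (((∫ e in (-hi)..hi, f e * ∫ v in (-π)..π, levelChartJac μ K (e, v + θ₀) *
          (fderiv ℝ (frameLevel μ K) (pairSumPath μ K ρ ϑ θ₀ 0 - levelPoint μ K e (v + θ₀)))
            (iteratedDeriv 1 (levelPoint μ K 0) θ₀ + iteratedDeriv 1 (levelPoint μ K ρ) (ϑ + θ₀)) *
        deriv (Kr e) (frameLevel μ K (pairSumPath μ K ρ ϑ θ₀ 0 - levelPoint μ K e (v + θ₀))) : ℝ) : ℂ)) :=
  funext fun θ₀ => (hasDerivAt_tubePiece_joint hA hA20 hd hr hlo hhi hA₃ hA₄ hK₁ hhi0 hhir hfc hfW hKd hKc0 hKc hK0 hK1 hρ ϑ θ₀).deriv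

/-- **THE TUBE PIECE IS `C¹` IN THE BASE ANGLE** (HEADLINE): under the hypotheses of `hasDerivAt_tubePiece_joint` (joint-`C⁰` kernel data, continuous bounded weight)
the function `θ ↦ ∫_{−hi}^{hi} f(e)·(∫_{(−π,π)} J(e,φ+θ)•K e(ē) dφ) de` is `ContDiff ℝ 1` — the `N = 1` smoothness clause of `CoMovingJetsL1Theta`.
[cite: BenfattoGiulianiMastropietro2006, §2.4 (2.40)] -/
theorem contDiff_one_tubePiece_joint {f : ℝ → ℝ} {hi W : ℝ} (hhi0 : 0 ≤ hi) (hhir : hi < r) (hfc : ContinuousOn f (Icc (-hi) hi))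
    (hfW : ∀ e ∈ Icc (-hi) hi, |f e| ≤ W)
    {Kr : ℝ → ℝ → ℝ} (hKd : ∀ e ∈ Icc (-hi) hi, ContDiff ℝ 2 (Kr e)) (hKc0 : Continuous fun p : ℝ × ℝ => Kr p.1 p.2)
    (hKc : Continuous fun p : ℝ × ℝ => deriv (Kr p.1) p.2) {M₀ M₁ : ℝ} (hK0 : ∀ e ∈ Icc (-hi) hi, ∀ u, |Kr e u| ≤ M₀)
    (hK1 : ∀ e ∈ Icc (-hi) hi, ∀ u, |deriv (Kr e) u| ≤ M₁) {ρ : ℝ} (hρ : |ρ| < r) (ϑ : ℝ) :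
    ContDiff ℝ 1 (fun θ : ℝ => ∫ e in (-hi)..hi, ((f e : ℝ) : ℂ) * ∫ φ in Ioo (-π) π,
        (levelChartJac μ K (e, φ + θ) : ℝ) • ((Kr e (frameLevel μ K (levelPoint μ K 0 θ + levelPoint μ K ρ (ϑ + θ) - levelPoint μ K e (φ + θ))) : ℝ) : ℂ)) := by
  rw [show (1 : WithTop ℕ∞) = ((0 : ℕ) : WithTop ℕ∞) + 1 from rfl, contDiff_succ_iff_deriv]
  refine ⟨fun θ₀ => (hasDerivAt_tubePiece_joint hA hA20 hd hr hlo hhi hA₃ hA₄ hK₁ hhi0 hhir hfc hfW hKd hKc0 hKc hK0 hK1 hρ ϑ θ₀).differentiableAt,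
    by simp, ?_⟩
  rw [deriv_tubePiece_joint hA hA20 hd hr hlo hhi hA₃ hA₄ hK₁ hhi0 hhir hfc hfW hKd hKc0 hKc hK0 hK1 hρ ϑ]
  exact contDiff_zero.2 (Complex.continuous_ofReal.comp (continuous_firstOrderLevelBox hA hd hr hlo hhi hρ ϑ hhi0 hhir hfc hKc))

end Sizes

end Summit.HubbardSuperconductivity.HubbardSuperconductivity.Theorems.C4a

end
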